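import Mathlib
import Summits.Ventures.FusionMHD.Models.FluxSurfacePolarRay
import HarnessLib

/-!
# Polar-ray GLUE: the least ray root `ρ(θ)`, its bracket and CONTINUITY from panel certificates, the θ-integral functional
# `∫ ρ/(R·D) dθ` and its PANEL-SUM bracket — what turns per-panel range certificates into a certified bracket, with no
# implicit-function theorem

LADDER-GRIDFUSION (F2 item R2; lead g6 RULING 7l (2) «F2.R2-POLAR-GLUE», LOW), cell `gridfusion`, seat `gridfusion-model-7` (g2),
2026-08-27.  Companion of `Models/FluxSurfacePolarRay.lean` (#88, p530205; the RULING asked for a §4 APPEND there — filed as its own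
file only because the append would exceed the 400-line rule; nothing in #88's file changes) and of the measured panel cell
`Models/CerfonFreidbergIterLikePolarPanel.lean` (p531704), whose kernel facts have exactly the shape of the PANEL HYPOTHESES below.
Elementary real analysis, [folklore]; no equilibrium, no device.

WHAT IS PROVED (all for an arbitrary flux function `ψ : ℝ → ℝ → ℝ`, centre `(R_c, Z_c)`, level `u`):
* §1 `rayRadius ψ R_c Z_c u θ := sInf {s > 0 | ψ(ray s) = u}` — the LEAST positive radius at which the ray in direction `θ` meets
  the level set.  `rayRadius_spec`: under the PANEL HYPOTHESES at `θ` — `ψ(ray s) < u` for `0 < s ≤ s₁`; `s ↦ ψ(ray s)` continuous and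
  strictly increasing on `[s₁, s₂]`; `ψ(ray s₂) > u` — one has `ρ(θ) ∈ (s₁, s₂)`, `ψ(ray ρ(θ)) = u`, and `ρ(θ)` is the ONLY root in
  `(0, s₂]` (so the surface's first crossing along the ray is certified, not assumed).
* §2 `continuousOn_rayRadius`: if the ray profile `(θ, s) ↦ ψ(ray_θ s)` is jointly continuous on `[a, b] × [s₁, s₂]` (true for a
  log-bearing flux wherever `R > 0`) and the panel hypotheses hold for every `θ ∈ [a, b]` with one bracket
  `[s₁, s₂]`, then `θ ↦ ρ(θ)` is CONTINUOUS on `[a, b]` (ε-argument: the strict inequalities at `ρ(θ₀) ± ε` persist for nearby `θ`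
  and strict monotonicity traps `ρ(θ)`); hence integrands built from `ρ` are integrable — measurability is never assumed.
* §3 `polarIntegrand ψ R_c Z_c u D θ := ρ(θ)/((R_c + ρ(θ) cos θ)·D(θ, ρ(θ)))` for a supplied radial-derivative field `D` (in the CF
  panel files `D = ∂_s ψ(ray s)`, a code-list evaluation, continuous); `polarIntegrand_bounds`: with `0 < d⁻ ≤ D ≤ d⁺` and
  `0 < R⁻ ≤ R_c + s cos θ ≤ R⁺` on panel × bracket, `s₁/(R⁺d⁺) ≤ integrand ≤ s₂/(R⁻d⁻)`; `continuousOn_polarIntegrand`;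
  `panel_integral_bounds`: `(b − a)s₁/(R⁺d⁺) ≤ ∫ₐᵇ integrand ≤ (b − a)s₂/(R⁻d⁻)`; `sum_panel_bounds`: a monotone partition adds
  the panel brackets (`intervalIntegral.sum_integral_adjacent_intervals`).
READING.  With `D = D_r` the integral `∫₀^{2π} ρ/(R·D_r) dθ` is `(2π/F)·q` by `PolarRay.safetyFactorE_eq_polar` WHEN `ρ` is
differentiable (the (6.35) identification, §2 of #88); this file certifies brackets of the θ-integral functional itself, which is
what the SIZED-ASK AM49 «certified q/F on a CF surface» item sums (250 panel files + one summation file instantiate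
`panel_integral_bounds` / `sum_panel_bounds`).  MODELLED: nothing.  NOT CLAIMED: differentiability of `ρ`; any value for any
equilibrium.
-/

noncomputable section

open Real Set MeasureTheory intervalIntegral Filter Topology

namespace Summit.Ventures.FusionMHD.Models

namespace PolarRay

/-- The set of positive ray radii at which the profile meets the level `u`. [folklore] -/
def rootSet (ψ : ℝ → ℝ → ℝ) (Rc Zc u θ : ℝ) : Set ℝ := {s : ℝ | 0 < s ∧ rayProfile ψ Rc Zc θ s = u}

/-- THE RAY RADIUS `ρ(θ)`: the least positive radius at which the ray from `(R_c, Z_c)` in direction `θ` meets the level set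
`ψ = u` (an `sInf`; meaningful under the panel hypotheses below, which make it THE unique root in the certified bracket). [folklore] -/
def rayRadius (ψ : ℝ → ℝ → ℝ) (Rc Zc u θ : ℝ) : ℝ := sInf (rootSet ψ Rc Zc u θ)

section panel

variable {ψ : ℝ → ℝ → ℝ} {Rc Zc u θ s₁ s₂ : ℝ}

/-- **PANEL HYPOTHESES ⇒ THE RAY RADIUS IS THE UNIQUE ROOT IN THE BRACKET.**  If along the ray the profile is `< u` on `(0, s₁]`,
continuous and strictly increasing on `[s₁, s₂]`, and `> u` at `s₂`, then `ρ(θ) ∈ (s₁, s₂)`, `ψ(ray ρ(θ)) = u`, and `ρ(θ)` is the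
ONLY root in `(0, s₂]`. [folklore] -/
theorem rayRadius_spec (hs₁ : 0 < s₁) (hs : s₁ ≤ s₂)
    (hin : ∀ s, 0 < s → s ≤ s₁ → rayProfile ψ Rc Zc θ s < u)
    (hcont : ContinuousOn (rayProfile ψ Rc Zc θ) (Icc s₁ s₂))
    (hmono : StrictMonoOn (rayProfile ψ Rc Zc θ) (Icc s₁ s₂))
    (hout : u < rayProfile ψ Rc Zc θ s₂) :
    rayRadius ψ Rc Zc u θ ∈ Ioo s₁ s₂ ∧ rayProfile ψ Rc Zc θ (rayRadius ψ Rc Zc u θ) = u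
      ∧ ∀ s, 0 < s → s ≤ s₂ → rayProfile ψ Rc Zc θ s = u → s = rayRadius ψ Rc Zc u θ := by
  set f := rayProfile ψ Rc Zc θ with hf
  -- a root in [s₁, s₂] by the intermediate value theorem
  have h1 : f s₁ < u := hin s₁ hs₁ le_rfl
  obtain ⟨r, hrI, hr⟩ : ∃ r ∈ Icc s₁ s₂, f r = u := by
    have := intermediate_value_Icc hs hcont
    exact this ⟨h1.le, hout.le⟩
  have hr1 : s₁ < r := lt_of_le_of_ne hrI.1 (by intro h; rw [← h] at hr; exact (ne_of_lt h1) hr)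
  have hr2 : r < s₂ := lt_of_le_of_ne hrI.2 (by intro h; rw [h] at hr; exact (ne_of_gt hout) hr)
  have hr0 : 0 < r := hs₁.trans hr1
  -- every root in (0, s₂] equals r
  have huniq : ∀ s, 0 < s → s ≤ s₂ → f s = u → s = r := by
    intro s hs0 hs2 hsu
    have hss₁ : s₁ < s := by
      by_contra hle
      exact (ne_of_lt (hin s hs0 (not_lt.1 hle))) hsu
    exact hmono.injOn ⟨hss₁.le, hs2⟩ hrI (by rw [hsu, hr])
  -- every root is ≥ r (roots beyond s₂ are larger than r < s₂)
  have hlb : ∀ s ∈ rootSet ψ Rc Zc u θ, r ≤ s := by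
    rintro s ⟨hs0, hsu⟩
    by_cases hs2 : s ≤ s₂
    · exact (huniq s hs0 hs2 hsu).ge
    · exact (hr2.trans (not_le.1 hs2)).le
  have hrmem : r ∈ rootSet ψ Rc Zc u θ := ⟨hr0, hr⟩
  have hne : (rootSet ψ Rc Zc u θ).Nonempty := ⟨r, hrmem⟩
  have hbdd : BddBelow (rootSet ψ Rc Zc u θ) := ⟨r, hlb⟩
  have heq : rayRadius ψ Rc Zc u θ = r :=
    le_antisymm (csInf_le hbdd hrmem) (le_csInf hne hlb)
  rw [heq]
  exact ⟨⟨hr1, hr2⟩, hr, huniq⟩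

end panel

/-! ## Continuity of the ray radius on a panel (elementary implicit-function continuity: no derivative in θ needed) -/

section continuity

variable {ψ : ℝ → ℝ → ℝ} {Rc Zc u a b s₁ s₂ : ℝ}

/-- **CONTINUITY OF `ρ(θ)` ON A PANEL.**  If the ray profile `(θ, s) ↦ ψ(ray_θ s)` is jointly continuous on the box
`[a, b] × [s₁, s₂]` (for a flux with a logarithm this holds wherever `R > 0`) and the panel hypotheses hold at every `θ ∈ [a, b]` with
the SAME bracket `[s₁, s₂]`, then `θ ↦ ρ(θ)` is continuous on `[a, b]`. [folklore] -/
theorem continuousOn_rayRadius (hF : ContinuousOn (fun p : ℝ × ℝ => rayProfile ψ Rc Zc p.1 p.2) (Icc a b ×ˢ Icc s₁ s₂))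
    (hs₁ : 0 < s₁) (hs : s₁ ≤ s₂)
    (hin : ∀ θ ∈ Icc a b, ∀ s, 0 < s → s ≤ s₁ → rayProfile ψ Rc Zc θ s < u)
    (hmono : ∀ θ ∈ Icc a b, StrictMonoOn (rayProfile ψ Rc Zc θ) (Icc s₁ s₂))
    (hout : ∀ θ ∈ Icc a b, u < rayProfile ψ Rc Zc θ s₂) :
    ContinuousOn (rayRadius ψ Rc Zc u) (Icc a b) := by
  -- sections of the jointly continuous ray profile
  have hcontθ : ∀ θ ∈ Icc a b, ContinuousOn (rayProfile ψ Rc Zc θ) (Icc s₁ s₂) := by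
    intro θ hθ
    have hmap : MapsTo (fun s : ℝ => ((θ, s) : ℝ × ℝ)) (Icc s₁ s₂) (Icc a b ×ˢ Icc s₁ s₂) :=
      fun s hs' => ⟨hθ, hs'⟩
    exact hF.comp (Continuous.prodMk continuous_const continuous_id).continuousOn hmap
  have hconts : ∀ s ∈ Icc s₁ s₂, ContinuousOn (fun θ => rayProfile ψ Rc Zc θ s) (Icc a b) := by
    intro s hs'
    have hmap : MapsTo (fun θ : ℝ => ((θ, s) : ℝ × ℝ)) (Icc a b) (Icc a b ×ˢ Icc s₁ s₂) :=
      fun θ hθ => ⟨hθ, hs'⟩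
    exact hF.comp (Continuous.prodMk continuous_id continuous_const).continuousOn hmap
  intro θ₀ hθ₀
  obtain ⟨hρI, hρu, huniq⟩ := rayRadius_spec hs₁ hs (hin θ₀ hθ₀) (hcontθ θ₀ hθ₀) (hmono θ₀ hθ₀) (hout θ₀ hθ₀)
  set ρ₀ := rayRadius ψ Rc Zc u θ₀ with hρ₀
  rw [Metric.continuousWithinAt_iff]
  intro ε hε
  -- shrink ε so that [ρ₀ - ε', ρ₀ + ε'] ⊆ (s₁, s₂)
  set ε' := min (ε / 2) (min ((ρ₀ - s₁) / 2) ((s₂ - ρ₀) / 2)) with hε'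
  have hε'pos : 0 < ε' := by
    have h1 : 0 < (ρ₀ - s₁) / 2 := by linarith [hρI.1]
    have h2 : 0 < (s₂ - ρ₀) / 2 := by linarith [hρI.2]
    exact lt_min (by linarith) (lt_min h1 h2)
  have hε'le : ε' ≤ ε / 2 := min_le_left _ _
  have hlo : s₁ < ρ₀ - ε' := by
    have : ε' ≤ (ρ₀ - s₁) / 2 := (min_le_right _ _).trans (min_le_left _ _)
    linarith [hρI.1]
  have hhi : ρ₀ + ε' < s₂ := by
    have : ε' ≤ (s₂ - ρ₀) / 2 := (min_le_right _ _).trans (min_le_right _ _)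
    linarith [hρI.2]
  -- at θ₀: f(ρ₀ - ε') < u < f(ρ₀ + ε') by strict monotonicity
  have hm := hmono θ₀ hθ₀
  have hlow : rayProfile ψ Rc Zc θ₀ (ρ₀ - ε') < u := by
    rw [← hρu]
    exact hm ⟨hlo.le, by linarith [hρI.2]⟩ ⟨hρI.1.le, hρI.2.le⟩ (by linarith)
  have hupp : u < rayProfile ψ Rc Zc θ₀ (ρ₀ + ε') := by
    rw [← hρu]
    exact hm ⟨hρI.1.le, hρI.2.le⟩ ⟨by linarith [hρI.1], hhi.le⟩ (by linarith)
  -- by continuity in θ these two strict inequalities persist near θ₀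
  have hm1 : ρ₀ - ε' ∈ Icc s₁ s₂ := ⟨hlo.le, by linarith [hρI.2]⟩
  have hm2 : ρ₀ + ε' ∈ Icc s₁ s₂ := ⟨by linarith [hρI.1], hhi.le⟩
  have hc1 : ContinuousWithinAt (fun θ => rayProfile ψ Rc Zc θ (ρ₀ - ε')) (Icc a b) θ₀ := hconts _ hm1 θ₀ hθ₀
  have hc2 : ContinuousWithinAt (fun θ => rayProfile ψ Rc Zc θ (ρ₀ + ε')) (Icc a b) θ₀ := hconts _ hm2 θ₀ hθ₀
  have hev1 : ∀ᶠ θ in 𝓝[Icc a b] θ₀, rayProfile ψ Rc Zc θ (ρ₀ - ε') < u := hc1.eventually (gt_mem_nhds hlow)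
  have hev2 : ∀ᶠ θ in 𝓝[Icc a b] θ₀, u < rayProfile ψ Rc Zc θ (ρ₀ + ε') := hc2.eventually (lt_mem_nhds hupp)
  obtain ⟨δ, hδ, hball⟩ := Metric.mem_nhdsWithin_iff.1 (hev1.and hev2)
  refine ⟨δ, hδ, fun θ hθ hdist => ?_⟩
  obtain ⟨h1θ, h2θ⟩ : rayProfile ψ Rc Zc θ (ρ₀ - ε') < u ∧ u < rayProfile ψ Rc Zc θ (ρ₀ + ε') :=
    hball ⟨Metric.mem_ball.2 hdist, hθ⟩
  -- the root at θ lies in (ρ₀ - ε', ρ₀ + ε') by the panel spec applied to the sub-bracket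
  obtain ⟨hρθI, hρθu, huniqθ⟩ := rayRadius_spec hs₁ hs (hin θ hθ) (hcontθ θ hθ) (hmono θ hθ) (hout θ hθ)
  have hmθ := hmono θ hθ
  set ρθ := rayRadius ψ Rc Zc u θ
  -- compare with the two test radii using strict monotonicity on [s₁, s₂]
  have hgt : ρ₀ - ε' < ρθ := by
    by_contra hle
    have hle' : ρθ ≤ ρ₀ - ε' := not_lt.1 hle
    have : rayProfile ψ Rc Zc θ ρθ ≤ rayProfile ψ Rc Zc θ (ρ₀ - ε') :=
      hmθ.monotoneOn ⟨hρθI.1.le, hρθI.2.le⟩ ⟨hlo.le, by linarith⟩ hle'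
    linarith [hρθu]
  have hlt : ρθ < ρ₀ + ε' := by
    by_contra hle
    have hle' : ρ₀ + ε' ≤ ρθ := not_lt.1 hle
    have : rayProfile ψ Rc Zc θ (ρ₀ + ε') ≤ rayProfile ψ Rc Zc θ ρθ :=
      hmθ.monotoneOn ⟨by linarith [hρI.1], hhi.le⟩ ⟨hρθI.1.le, hρθI.2.le⟩ hle'
    linarith [hρθu]
  rw [Real.dist_eq, abs_lt]
  constructor <;> linarith

end continuity

/-! ## The θ-integral functional and its panel-sum bracket -/

section functional

variable {ψ : ℝ → ℝ → ℝ} {Rc Zc u : ℝ}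

/-- The polar `q`-type integrand `ρ(θ)/(R(θ)·D(θ, ρ(θ)))`, `R(θ) = R_c + ρ(θ) cos θ`, for a supplied radial-derivative field
`D(θ, s)` (in applications `D = ∂_s ψ(ray)`, so that this is `dl/(R|∇ψ|)` per unit `θ` by `FluxSurfacePolarRay`). [folklore] -/
def polarIntegrand (ψ : ℝ → ℝ → ℝ) (Rc Zc u : ℝ) (D : ℝ → ℝ → ℝ) (θ : ℝ) : ℝ :=
  rayRadius ψ Rc Zc u θ / ((Rc + rayRadius ψ Rc Zc u θ * cos θ) * D θ (rayRadius ψ Rc Zc u θ))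

/-- **ONE PANEL**: under the panel hypotheses (profile `< u` on `(0, s₁]`, strictly increasing on `[s₁, s₂]` with `> u` at `s₂`,
for every `θ ∈ [a, b]`), a jointly continuous radial-derivative field `D` with `0 < d⁻ ≤ D ≤ d⁺` on the panel × bracket, and
`0 < R⁻ ≤ R_c + s cos θ ≤ R⁺` there, the integrand is continuous on the panel and BRACKETED:
`s₁/(R⁺d⁺) ≤ ρ/(R·D) ≤ s₂/(R⁻d⁻)`. [folklore] -/
theorem polarIntegrand_bounds {a b s₁ s₂ dlo dhi Rlo Rhi : ℝ} {D : ℝ → ℝ → ℝ}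
    (hF : ContinuousOn (fun p : ℝ × ℝ => rayProfile ψ Rc Zc p.1 p.2) (Icc a b ×ˢ Icc s₁ s₂)) (hs₁ : 0 < s₁) (hs : s₁ ≤ s₂)
    (hin : ∀ θ ∈ Icc a b, ∀ s, 0 < s → s ≤ s₁ → rayProfile ψ Rc Zc θ s < u)
    (hmono : ∀ θ ∈ Icc a b, StrictMonoOn (rayProfile ψ Rc Zc θ) (Icc s₁ s₂))
    (hout : ∀ θ ∈ Icc a b, u < rayProfile ψ Rc Zc θ s₂)
    (hdlo : 0 < dlo) (hD : ∀ θ ∈ Icc a b, ∀ s ∈ Icc s₁ s₂, dlo ≤ D θ s ∧ D θ s ≤ dhi)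
    (hRlo : 0 < Rlo) (hR : ∀ θ ∈ Icc a b, ∀ s ∈ Icc s₁ s₂, Rlo ≤ Rc + s * cos θ ∧ Rc + s * cos θ ≤ Rhi)
    {θ : ℝ} (hθ : θ ∈ Icc a b) :
    s₁ / (Rhi * dhi) ≤ polarIntegrand ψ Rc Zc u D θ ∧ polarIntegrand ψ Rc Zc u D θ ≤ s₂ / (Rlo * dlo) := by
  have hcontθ : ContinuousOn (rayProfile ψ Rc Zc θ) (Icc s₁ s₂) := by
    have hmap : MapsTo (fun s : ℝ => ((θ, s) : ℝ × ℝ)) (Icc s₁ s₂) (Icc a b ×ˢ Icc s₁ s₂) := fun s hs' => ⟨hθ, hs'⟩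
    exact hF.comp (Continuous.prodMk continuous_const continuous_id).continuousOn hmap
  unfold polarIntegrand
  obtain ⟨hρI, -, -⟩ := rayRadius_spec hs₁ hs (hin θ hθ) hcontθ (hmono θ hθ) (hout θ hθ)
  set ρ := rayRadius ψ Rc Zc u θ
  have hρmem : ρ ∈ Icc s₁ s₂ := ⟨hρI.1.le, hρI.2.le⟩
  obtain ⟨hD1, hD2⟩ := hD θ hθ ρ hρmem
  obtain ⟨hR1, hR2⟩ := hR θ hθ ρ hρmem
  have hDpos : 0 < D θ ρ := hdlo.trans_le hD1
  have hRpos : 0 < Rc + ρ * cos θ := hRlo.trans_le hR1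
  have hdhi : 0 < dhi := lt_of_lt_of_le hdlo (hD1.trans hD2)
  have hRhi : 0 < Rhi := lt_of_lt_of_le hRlo (hR1.trans hR2)
  set P := (Rc + ρ * cos θ) * D θ ρ with hP
  have hPpos : 0 < P := mul_pos hRpos hDpos
  constructor
  · rw [div_le_div_iff₀ (mul_pos hRhi hdhi) hPpos]
    have hPle : P ≤ Rhi * dhi := mul_le_mul hR2 hD2 hDpos.le hRhi.le
    have h1 : s₁ * P ≤ s₁ * (Rhi * dhi) := mul_le_mul_of_nonneg_left hPle hs₁.le
    have h2 : s₁ * (Rhi * dhi) ≤ ρ * (Rhi * dhi) := mul_le_mul_of_nonneg_right hρI.1.le (mul_pos hRhi hdhi).le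
    linarith
  · rw [div_le_div_iff₀ hPpos (mul_pos hRlo hdlo)]
    have hPge : Rlo * dlo ≤ P := mul_le_mul hR1 hD1 hdlo.le hRpos.le
    have h1 : ρ * (Rlo * dlo) ≤ ρ * P := mul_le_mul_of_nonneg_left hPge (hs₁.le.trans hρI.1.le)
    have h2 : ρ * P ≤ s₂ * P := mul_le_mul_of_nonneg_right hρI.2.le hPpos.le
    linarith

/-- … and CONTINUOUS on the panel (so integrable), when the ray profile and `D` are jointly continuous on panel × bracket. [folklore] -/
theorem continuousOn_polarIntegrand {a b s₁ s₂ dlo dhi Rlo Rhi : ℝ} {D : ℝ → ℝ → ℝ}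
    (hF : ContinuousOn (fun p : ℝ × ℝ => rayProfile ψ Rc Zc p.1 p.2) (Icc a b ×ˢ Icc s₁ s₂))
    (hDc : ContinuousOn (fun p : ℝ × ℝ => D p.1 p.2) (Icc a b ×ˢ Icc s₁ s₂)) (hs₁ : 0 < s₁) (hs : s₁ ≤ s₂)
    (hin : ∀ θ ∈ Icc a b, ∀ s, 0 < s → s ≤ s₁ → rayProfile ψ Rc Zc θ s < u)
    (hmono : ∀ θ ∈ Icc a b, StrictMonoOn (rayProfile ψ Rc Zc θ) (Icc s₁ s₂))
    (hout : ∀ θ ∈ Icc a b, u < rayProfile ψ Rc Zc θ s₂)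
    (hdlo : 0 < dlo) (hD : ∀ θ ∈ Icc a b, ∀ s ∈ Icc s₁ s₂, dlo ≤ D θ s ∧ D θ s ≤ dhi)
    (hRlo : 0 < Rlo) (hR : ∀ θ ∈ Icc a b, ∀ s ∈ Icc s₁ s₂, Rlo ≤ Rc + s * cos θ ∧ Rc + s * cos θ ≤ Rhi) :
    ContinuousOn (polarIntegrand ψ Rc Zc u D) (Icc a b) := by
  have hρc := continuousOn_rayRadius hF hs₁ hs hin hmono hout
  have hcontθ : ∀ θ ∈ Icc a b, ContinuousOn (rayProfile ψ Rc Zc θ) (Icc s₁ s₂) := by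
    intro θ hθ
    have hmap : MapsTo (fun s : ℝ => ((θ, s) : ℝ × ℝ)) (Icc s₁ s₂) (Icc a b ×ˢ Icc s₁ s₂) := fun s hs' => ⟨hθ, hs'⟩
    exact hF.comp (Continuous.prodMk continuous_const continuous_id).continuousOn hmap
  have hρin : ∀ θ ∈ Icc a b, rayRadius ψ Rc Zc u θ ∈ Icc s₁ s₂ := by
    intro θ hθ
    obtain ⟨hρI, -, -⟩ := rayRadius_spec hs₁ hs (hin θ hθ) (hcontθ θ hθ) (hmono θ hθ) (hout θ hθ)
    exact ⟨hρI.1.le, hρI.2.le⟩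
  unfold polarIntegrand
  apply ContinuousOn.div hρc
  · apply ContinuousOn.mul
    · exact continuousOn_const.add (hρc.mul (continuous_cos.continuousOn))
    · -- θ ↦ D θ (ρ θ) = D ∘ (θ, ρ θ), and (θ, ρ θ) stays in the box
      have hpair : ContinuousOn (fun θ => ((θ, rayRadius ψ Rc Zc u θ) : ℝ × ℝ)) (Icc a b) :=
        continuousOn_id.prodMk hρc
      have hmap : MapsTo (fun θ => ((θ, rayRadius ψ Rc Zc u θ) : ℝ × ℝ)) (Icc a b) (Icc a b ×ˢ Icc s₁ s₂) :=
        fun θ hθ => ⟨hθ, hρin θ hθ⟩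
      exact hDc.comp hpair hmap
  · intro θ hθ
    obtain ⟨hρI, -, -⟩ := rayRadius_spec hs₁ hs (hin θ hθ) (hcontθ θ hθ) (hmono θ hθ) (hout θ hθ)
    have hρmem : rayRadius ψ Rc Zc u θ ∈ Icc s₁ s₂ := ⟨hρI.1.le, hρI.2.le⟩
    have hDpos : 0 < D θ (rayRadius ψ Rc Zc u θ) := hdlo.trans_le (hD θ hθ _ hρmem).1
    have hRpos : 0 < Rc + rayRadius ψ Rc Zc u θ * cos θ := hRlo.trans_le (hR θ hθ _ hρmem).1
    exact (mul_pos hRpos hDpos).ne'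

/-- **THE PANEL INTEGRAL BRACKET**: `(b − a)·s₁/(R⁺d⁺) ≤ ∫ₐᵇ ρ/(R·D) dθ ≤ (b − a)·s₂/(R⁻d⁻)`. [folklore] -/
theorem panel_integral_bounds {a b s₁ s₂ dlo dhi Rlo Rhi : ℝ} {D : ℝ → ℝ → ℝ}
    (hF : ContinuousOn (fun p : ℝ × ℝ => rayProfile ψ Rc Zc p.1 p.2) (Icc a b ×ˢ Icc s₁ s₂))
    (hDc : ContinuousOn (fun p : ℝ × ℝ => D p.1 p.2) (Icc a b ×ˢ Icc s₁ s₂)) (hab : a ≤ b) (hs₁ : 0 < s₁) (hs : s₁ ≤ s₂)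
    (hin : ∀ θ ∈ Icc a b, ∀ s, 0 < s → s ≤ s₁ → rayProfile ψ Rc Zc θ s < u)
    (hmono : ∀ θ ∈ Icc a b, StrictMonoOn (rayProfile ψ Rc Zc θ) (Icc s₁ s₂))
    (hout : ∀ θ ∈ Icc a b, u < rayProfile ψ Rc Zc θ s₂)
    (hdlo : 0 < dlo) (hD : ∀ θ ∈ Icc a b, ∀ s ∈ Icc s₁ s₂, dlo ≤ D θ s ∧ D θ s ≤ dhi)
    (hRlo : 0 < Rlo) (hR : ∀ θ ∈ Icc a b, ∀ s ∈ Icc s₁ s₂, Rlo ≤ Rc + s * cos θ ∧ Rc + s * cos θ ≤ Rhi) :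
    (b - a) * (s₁ / (Rhi * dhi)) ≤ ∫ θ in a..b, polarIntegrand ψ Rc Zc u D θ
      ∧ ∫ θ in a..b, polarIntegrand ψ Rc Zc u D θ ≤ (b - a) * (s₂ / (Rlo * dlo)) := by
  have hc := continuousOn_polarIntegrand hF hDc hs₁ hs hin hmono hout hdlo hD hRlo hR
  have hint : IntervalIntegrable (polarIntegrand ψ Rc Zc u D) volume a b :=
    (hc.mono (by rw [uIcc_of_le hab])).intervalIntegrable
  have hb : ∀ θ ∈ Icc a b, s₁ / (Rhi * dhi) ≤ polarIntegrand ψ Rc Zc u D θ ∧ polarIntegrand ψ Rc Zc u D θ ≤ s₂ / (Rlo * dlo) :=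
    fun θ hθ => polarIntegrand_bounds hF hs₁ hs hin hmono hout hdlo hD hRlo hR hθ
  constructor
  · have := intervalIntegral.integral_mono_on hab intervalIntegrable_const hint (fun θ hθ => (hb θ hθ).1)
    rw [intervalIntegral.integral_const, smul_eq_mul] at this
    linarith [mul_div_assoc (b - a) s₁ (Rhi * dhi)]
  · have := intervalIntegral.integral_mono_on hab hint intervalIntegrable_const (fun θ hθ => (hb θ hθ).2)
    rw [intervalIntegral.integral_const, smul_eq_mul] at this
    linarith [mul_div_assoc (b - a) s₂ (Rlo * dlo)]

/-- **PANEL SUM**: for a monotone partition `t₀ ≤ t₁ ≤ … ≤ t_N` and per-panel brackets `lo i ≤ ∫_{tᵢ}^{tᵢ₊₁} f ≤ hi i` of an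
integrand integrable on every panel, `Σ lo ≤ ∫_{t₀}^{t_N} f ≤ Σ hi`. [folklore] -/
theorem sum_panel_bounds {N : ℕ} {t : ℕ → ℝ} {f : ℝ → ℝ} {lo hi : ℕ → ℝ}
    (hint : ∀ i < N, IntervalIntegrable f volume (t i) (t (i + 1)))
    (hlo : ∀ i < N, lo i ≤ ∫ θ in t i..t (i + 1), f θ) (hhi : ∀ i < N, ∫ θ in t i..t (i + 1), f θ ≤ hi i) :
    (∑ i ∈ Finset.range N, lo i) ≤ ∫ θ in t 0..t N, f θ ∧ ∫ θ in t 0..t N, f θ ≤ ∑ i ∈ Finset.range N, hi i := by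
  rw [← intervalIntegral.sum_integral_adjacent_intervals hint]
  exact ⟨Finset.sum_le_sum fun i hi' => hlo i (Finset.mem_range.1 hi'),
    Finset.sum_le_sum fun i hi' => hhi i (Finset.mem_range.1 hi')⟩

end functional

end PolarRay

end Summit.Ventures.FusionMHD.Models

end
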